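import Summits.QuantumFields.YangMills.Theorems.SwapTwistDeficitPolyakovHolonomy
import Summits.QuantumFields.YangMills.Theorems.LuscherReductionOneSiteLevelsActionLipschitz
import Summits.QuantumFields.YangMills.Theorems.LuscherReductionRunningReductionTraceFormulaAveraging
import HarnessLib

/-!
# Pinning in an `x`-twisted seam sector: a configuration close to its own `x`-twisted gauge image has its `x`-Polyakov holonomy AT THE EQUATOR

Support module (`--supports` stmt-QuantumFields-23948; memo HOME `bc/g14-dw/SECTORS-translates.md` §1(a), which bears on the translate lines for
⟨23956⟩/⟨23957⟩/⟨23948⟩/⟨23949⟩ of seat ym-idea-4).  In the seam sector `z ∈ (ℤ/2)³` of the zero-flux ring (`TT.sectorWeight`, defs module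
`QuantileBitPuritySectorDefs`) the chain `U_0 → U_1 → ⋯ → U_n` closes through the bond `K_β(U_n, V)` with `V = g · tw_z U_0`.  On the good-field
event consecutive slices — INCLUDING the seam pair `(U_n, V)` — are linkwise `δ`-close, so `V` is `(n+1)δ`-close to `U_0` itself.  If the sector
twists the `x`-sheet (`z 0 = true`), the `x`-axis through the origin carries exactly one twisted link and
`P(V) = g(0) · (−P(U_0)) · g(0)⁻¹` EXACTLY (`polyX_gaugeTransform`, `polyX_twist_zero`, `polyX_twist_of_ne`), while `‖P(V) − P(U_0)‖_F ≤ L(n+1)δ`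
(`frobNorm_polyXAux_sub_le`).  Hence `|Re tr P(U_0)| ≤ L(n+1)δ` and

  ★ `two_sub_le_polDist_of_twisted_seam`:  `2 − L·r ≤ polDist U`  whenever `‖(g · tw_z U)(ℓ_j) − U(ℓ_j)‖_F ≤ r` on the axis links and `z 0 = true`;
  ★ `two_sub_le_polDist_of_twisted_sector`:  the chain form, `2 − L(n+1)δ ≤ polDist U_0`.

So on the good-field event the four sectors with `z 0 = true` live where `polDist ≈ 2` (its maximum): they do not meet a core `{polDist ≤ β^{-γc}}`
nor a strip `{|polDist − c| ≤ β^{-γ}}` with `c ≤ 2 − β^{-γ} − L(n+1)δ`, and they lie INSIDE such a strip when `c ≈ 2` (memo §2).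
Pure fixed-lattice matrix bookkeeping; no `sorry`, no new axiom, no new definition; nothing about infinite volume, the continuum limit or the Clay gap.
References: [cite: tHooft1979] (centre twists); [cite: Luscher1983, §2] (Polyakov holonomies on the torus).
-/

set_option autoImplicit false

noncomputable section

open Real
open scoped BigOperators Matrix
open Literature.MathematicalPhysics.QuantumLattice
open Literature.MathematicalPhysics.QuantumFieldTheory hiding SU2
open Summit.QuantumFields.YangMills.Theorems

namespace Summit.QuantumFields.YangMills.Theorems.FemtoTransferGap.FlatSheet

open Summit.QuantumFields.YangMills.Theorems.FemtoTransferGap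
open Summit.QuantumFields.YangMills.Theorems.FemtoTransferGap.TT

variable {L : ℕ} [NeZero L]

/-! ## §1 The `x`-holonomy of the `x`-twisted gauge image -/

/-- The composite twist multiplies the `x`-holonomy by the centre element of its `x`-component: `P(tw_z U) = centreElem (z 0) · P(U)`.
[cite: tHooft1979] [cite: Luscher1983, §2] -/
theorem polyX_twist3 (z : Fin 3 → Bool) (U : GaugeConfig 3 L SU2) : polyX (twist3 z U) = centreElem (z 0) * polyX U := by
  unfold twist3
  rw [polyX_twist_zero, polyX_twist_of_ne (by decide : (1 : Fin 3) ≠ 0), polyX_twist_of_ne (by decide : (2 : Fin 3) ≠ 0)]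

/-- **The `x`-holonomy of the `x`-twisted gauge image**: `P(g · tw_z U) = g(0) · (−P(U)) · g(0)⁻¹` when `z 0 = true`. [cite: tHooft1979] [cite: Luscher1983, §2] -/
theorem polyX_act_of_twisted {z : Fin 3 → Bool} (hz : z 0 = true) (g : Site 3 L → SU2) (U : GaugeConfig 3 L SU2) :
    polyX (gaugeTransform g (twist3 z U)) = g 0 * (negOne * polyX U) * (g 0)⁻¹ := by
  rw [polyX_gaugeTransform, polyX_twist3, hz]
  rfl

/-- Its trace is MINUS the trace of `P(U)`: `Re tr P(g · tw_z U) = −Re tr P(U)` (`z 0 = true`). [cite: tHooft1979] -/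
theorem re_trace_polyX_act_of_twisted {z : Fin 3 → Bool} (hz : z 0 = true) (g : Site 3 L → SU2) (U : GaugeConfig 3 L SU2) :
    (polyX (gaugeTransform g (twist3 z U)) : Matrix (Fin 2) (Fin 2) ℂ).trace.re = -(polyX U : Matrix (Fin 2) (Fin 2) ℂ).trace.re := by
  rw [polyX_act_of_twisted hz]
  have h : (((g 0 * (negOne * polyX U) * (g 0)⁻¹ : SU2)) : Matrix (Fin 2) (Fin 2) ℂ) =
      (g 0 : Matrix (Fin 2) (Fin 2) ℂ) * (-(polyX U : Matrix (Fin 2) (Fin 2) ℂ)) * ((g 0)⁻¹ : SU2) := by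
    rw [Submonoid.coe_mul, Submonoid.coe_mul, coe_negOne_mul]
  rw [h, Matrix.trace_mul_cycle, ← Submonoid.coe_mul, inv_mul_cancel]
  simp [Matrix.trace_neg]

/-! ## §2 Pinning at the equator -/

/-- **`|Re tr P(U)| ≤ L·r`** if the `x`-twisted gauge image `g · tw_z U` (`z 0 = true`) is `r`-close to `U` on the `L` links of the `x`-axis through
the origin (Frobenius norm). [cite: Luscher1983, §2] -/
theorem abs_re_trace_polyX_le_of_twisted_seam {z : Fin 3 → Bool} (hz : z 0 = true) (g : Site 3 L → SU2) (U : GaugeConfig 3 L SU2) {r : ℝ}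
    (h : ∀ j, j < L → frobNorm (((gaugeTransform g (twist3 z U)) (lineEdge L j) : Matrix (Fin 2) (Fin 2) ℂ) -
      (U (lineEdge L j) : Matrix (Fin 2) (Fin 2) ℂ)) ≤ r) :
    |(polyX U : Matrix (Fin 2) (Fin 2) ℂ).trace.re| ≤ L * r := by
  set V := gaugeTransform g (twist3 z U) with hV
  -- `‖P(V) − P(U)‖_F ≤ L r`
  have h1 : frobNorm ((polyX V : Matrix (Fin 2) (Fin 2) ℂ) - (polyX U : Matrix (Fin 2) (Fin 2) ℂ)) ≤ L * r := by
    refine (frobNorm_polyXAux_sub_le V U L).trans ?_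
    calc ∑ j ∈ Finset.range L, frobNorm ((V (lineEdge L j) : Matrix (Fin 2) (Fin 2) ℂ) - (U (lineEdge L j) : Matrix (Fin 2) (Fin 2) ℂ))
        ≤ ∑ _j ∈ Finset.range L, r := Finset.sum_le_sum fun j hj => h j (Finset.mem_range.1 hj)
      _ = L * r := by rw [Finset.sum_const, Finset.card_range, nsmul_eq_mul]
  -- `|Re tr (P(V) − P(U))| ≤ 2 L r` and `Re tr P(V) = −Re tr P(U)`
  have h2 := abs_re_trace_le_two_mul_frobNorm ((polyX V : Matrix (Fin 2) (Fin 2) ℂ) - (polyX U : Matrix (Fin 2) (Fin 2) ℂ))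
  rw [Matrix.trace_sub, Complex.sub_re, hV, re_trace_polyX_act_of_twisted hz] at h2
  have h3 : |-(polyX U : Matrix (Fin 2) (Fin 2) ℂ).trace.re - (polyX U : Matrix (Fin 2) (Fin 2) ℂ).trace.re| =
      2 * |(polyX U : Matrix (Fin 2) (Fin 2) ℂ).trace.re| := by
    rw [show -(polyX U : Matrix (Fin 2) (Fin 2) ℂ).trace.re - (polyX U : Matrix (Fin 2) (Fin 2) ℂ).trace.re =
      (-2) * (polyX U : Matrix (Fin 2) (Fin 2) ℂ).trace.re by ring, abs_mul]
    norm_num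
  rw [h3] at h2
  linarith

omit [NeZero L] in
/-- `polDist U² = 4 − 2|Re tr P(U)|` on `SU(2)` (`‖P ∓ 1‖_F² = 4 ∓ 2 Re tr P`). [folklore] -/
theorem polDist_sq_eq (U : GaugeConfig 3 L SU2) : polDist U ^ 2 = 4 - 2 * |(polyX U : Matrix (Fin 2) (Fin 2) ℂ).trace.re| := by
  have hm : frobNorm ((polyX U : Matrix (Fin 2) (Fin 2) ℂ) - 1) ^ 2 = 4 - 2 * (polyX U : Matrix (Fin 2) (Fin 2) ℂ).trace.re := by
    have h := two_sub_re_trace_eq (polyX U); linarith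
  have hp : frobNorm ((polyX U : Matrix (Fin 2) (Fin 2) ℂ) + 1) ^ 2 = 4 + 2 * (polyX U : Matrix (Fin 2) (Fin 2) ℂ).trace.re := by
    rw [frobNorm_add_one_sq_eq, hm]; ring
  have hm0 := frobNorm_nonneg ((polyX U : Matrix (Fin 2) (Fin 2) ℂ) - 1)
  have hp0 := frobNorm_nonneg ((polyX U : Matrix (Fin 2) (Fin 2) ℂ) + 1)
  unfold polDist vacDist
  by_cases ht : 0 ≤ (polyX U : Matrix (Fin 2) (Fin 2) ℂ).trace.re
  · rw [abs_of_nonneg ht, min_eq_left, hm]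
    exact pow_le_pow_iff_left₀ hm0 hp0 two_ne_zero |>.1 (by rw [hm, hp]; linarith)
  · rw [not_le] at ht
    rw [abs_of_neg ht, min_eq_right, hp]
    · ring
    exact pow_le_pow_iff_left₀ hp0 hm0 two_ne_zero |>.1 (by rw [hm, hp]; linarith)

/-- ★ **Pinning at the equator**: if the `x`-twisted gauge image `g · tw_z U` (`z 0 = true`) is `r`-close to `U` on the links of the `x`-axis through
the origin, then `2 − L·r ≤ polDist U` (recall `polDist ≤ 2`, with equality iff `tr P(U) = 0`). [cite: tHooft1979] [cite: Luscher1983, §2] -/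
theorem two_sub_le_polDist_of_twisted_seam {z : Fin 3 → Bool} (hz : z 0 = true) (g : Site 3 L → SU2) (U : GaugeConfig 3 L SU2) {r : ℝ}
    (h : ∀ j, j < L → frobNorm (((gaugeTransform g (twist3 z U)) (lineEdge L j) : Matrix (Fin 2) (Fin 2) ℂ) -
      (U (lineEdge L j) : Matrix (Fin 2) (Fin 2) ℂ)) ≤ r) :
    2 - L * r ≤ polDist U := by
  have h1 := abs_re_trace_polyX_le_of_twisted_seam hz g U h
  have h2 := polDist_sq_eq U
  have h3 := polDist_nonneg U
  have h4 := polDist_le_two U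
  -- `polDist² ≥ 4 − 2 L r`, and `√(4 − x) ≥ 2 − x/2` on `[0, 4]`
  by_cases hx : L * r ≤ 2
  · nlinarith [abs_nonneg ((polyX U : Matrix (Fin 2) (Fin 2) ℂ).trace.re)]
  · rw [not_le] at hx; linarith

/-! ## §3 The chain form -/

/-- Telescoping along a chain: consecutive `δ`-closeness gives `‖f(last) − f(0)‖_F ≤ n·δ`. [folklore] -/
theorem frobNorm_last_sub_zero_le {n : ℕ} (f : Fin (n + 1) → Matrix (Fin 2) (Fin 2) ℂ) {δ : ℝ}
    (h : ∀ i : Fin n, frobNorm (f i.succ - f i.castSucc) ≤ δ) : frobNorm (f (Fin.last n) - f 0) ≤ n * δ := by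
  -- `‖f k − f 0‖ ≤ k δ` for every `k ≤ n`
  have key : ∀ k (hk : k < n + 1), frobNorm (f ⟨k, hk⟩ - f 0) ≤ k * δ := by
    intro k
    induction k with
    | zero => intro hk; simp [frobNorm_zero]
    | succ k ih =>
      intro hk
      have hk' : k < n + 1 := by omega
      have hkn : k < n := by omega
      have hstep := h ⟨k, hkn⟩
      have hs : (⟨k, hkn⟩ : Fin n).succ = ⟨k + 1, hk⟩ := rfl
      have hc : (⟨k, hkn⟩ : Fin n).castSucc = ⟨k, hk'⟩ := rfl
      rw [hs, hc] at hstep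
      calc frobNorm (f ⟨k + 1, hk⟩ - f 0) = frobNorm ((f ⟨k + 1, hk⟩ - f ⟨k, hk'⟩) + (f ⟨k, hk'⟩ - f 0)) := by rw [sub_add_sub_cancel]
        _ ≤ frobNorm (f ⟨k + 1, hk⟩ - f ⟨k, hk'⟩) + frobNorm (f ⟨k, hk'⟩ - f 0) := frobNorm_add_le _ _
        _ ≤ δ + k * δ := add_le_add hstep (ih hk')
        _ = (k + 1 : ℕ) * δ := by push_cast; ring
  exact key n (Nat.lt_succ_self n)

/-- ★ **Pinning at the equator, chain form.**  Along a chain of slices `U_0, …, U_n` whose consecutive `x`-axis links are `δ`-close and whose SEAM pair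
`(U_n, g · tw_z U_0)` is `δ`-close on those links, in a sector with `z 0 = true`:  `2 − L(n+1)δ ≤ polDist U_0`.  (On the good-field event of the
zero-flux ring this is every configuration of the four `x`-twisted seam sectors.) [cite: tHooft1979] [cite: Luscher1983, §2] -/
theorem two_sub_le_polDist_of_twisted_sector {z : Fin 3 → Bool} (hz : z 0 = true) {n : ℕ} (Us : Fin (n + 1) → GaugeConfig 3 L SU2)
    (g : Site 3 L → SU2) {δ : ℝ}
    (hstep : ∀ (i : Fin n) (j : ℕ), j < L → frobNorm ((Us i.succ (lineEdge L j) : Matrix (Fin 2) (Fin 2) ℂ) -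
      (Us i.castSucc (lineEdge L j) : Matrix (Fin 2) (Fin 2) ℂ)) ≤ δ)
    (hseam : ∀ j, j < L → frobNorm (((gaugeTransform g (twist3 z (Us 0))) (lineEdge L j) : Matrix (Fin 2) (Fin 2) ℂ) -
      (Us (Fin.last n) (lineEdge L j) : Matrix (Fin 2) (Fin 2) ℂ)) ≤ δ) :
    2 - L * ((n + 1) * δ) ≤ polDist (Us 0) := by
  refine two_sub_le_polDist_of_twisted_seam hz g (Us 0) fun j hj => ?_
  have hchain := frobNorm_last_sub_zero_le (fun i => (Us i (lineEdge L j) : Matrix (Fin 2) (Fin 2) ℂ)) fun i => hstep i j hj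
  calc frobNorm (((gaugeTransform g (twist3 z (Us 0))) (lineEdge L j) : Matrix (Fin 2) (Fin 2) ℂ) - (Us 0 (lineEdge L j) : Matrix (Fin 2) (Fin 2) ℂ))
      = frobNorm ((((gaugeTransform g (twist3 z (Us 0))) (lineEdge L j) : Matrix (Fin 2) (Fin 2) ℂ) -
          (Us (Fin.last n) (lineEdge L j) : Matrix (Fin 2) (Fin 2) ℂ)) +
          ((Us (Fin.last n) (lineEdge L j) : Matrix (Fin 2) (Fin 2) ℂ) - (Us 0 (lineEdge L j) : Matrix (Fin 2) (Fin 2) ℂ))) := by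
        rw [sub_add_sub_cancel]
    _ ≤ δ + n * δ := (frobNorm_add_le _ _).trans (add_le_add (hseam j hj) hchain)
    _ = (n + 1) * δ := by ring

end Summit.QuantumFields.YangMills.Theorems.FemtoTransferGap.FlatSheet

end
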